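import Summits.HubbardSuperconductivity.HubbardSuperconductivity.Theorems.DeformationLadderLadderThesisNormalForms
import Literature.MathematicalPhysics.QuantumLattice.FinDimSpectrumProofs
import Literature.MathematicalPhysics.QuantumLattice.GroundStateSourceBounds
import Literature.MathematicalPhysics.QuantumLattice.TorusPairSusceptibility

/-!
# `LadderThesis` (stmt-HubbardSuperconductivity-1890) — the source–penalty transfer

Helpers for the crux `LadderThesis` of route `DeformationLadder`, formalising the first lemma of
crux-idea `mesoscopic-source-concavity` (crux-ideate r1 on this item) at finite side `L`:

* `star_dotProduct_mulVec_eq_zero_of_shifts` — an operator of nonzero `(N↑, N↓)`-grade has zero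
  expectation in every vector of a fixed `(N↑, N↓)` sector; hence the Hermitian `d`-wave pair SOURCE
  `Δ_d + Δ_dᴴ` has zero expectation in every fixed-`N` sector vector
  (`star_dotProduct_dWavePairSource_mulVec_eq_zero`).
* `groundEnergy_sourcedPenalised_le` — variational upper bound: the grand-canonical ground energy
  of the sourced AND penalised torus `H_L - μN - h(Δ_d + Δ_dᴴ) + s·Δ_dᴴΔ_d` is at most the
  `(2n, S^z=0)`-sector energy of `H_L + s·Δ_dᴴΔ_d` minus `2nμ` (trial state: a sector ground state
  of the penalised pure model — the source drops out).
* `groundEnergy_hubbardTorusWith_sub_le_groundEnergy_dWaveSourceTorus` — source removal costs at most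
  `8√2·|h|·L²` (`‖Δ_d + Δ_dᴴ‖ ≤ 8√2 L²` and the Hellmann–Feynman chord).
* `sourcePenaltyTransfer` — **the transfer**: if the filling `2n` is exposed at chemical potential
  `μ` (the grand-canonical ground energy of `H_L - μN` is attained in the sector,
  `E₀(H_L - μN) = minEnergyOn H_L (szSector 2n 0) - 2nμ`), then
  `E₀(sourced+penalised) - E₀(sourced) - 8√2|h|L² ≤ Φ_L(s)`, the SECTOR penalty shift
  `minEnergyOn (H_L + sΔ_dᴴΔ_d) - minEnergyOn H_L` on `szSector 2n 0` — the quantity whose uniform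
  positivity is `LadderThesis` (`ladderThesis_iff_penaltyGap`). No concavity or gauge evenness is
  needed for this direction.
* `smul_re_expect_pairPenalty_le_groundEnergy_sub`, `re_expect_pairField_sq_le` — the penalty shift
  dominates `s·Re⟨Ω, Δ_dᴴΔ_d Ω⟩` in a penalised ground vector `Ω` (finite-size Feynman–Hellmann), and
  Cauchy–Schwarz `(Re⟨Ω, Δ_d Ω⟩)² ≤ Re⟨Ω, Δ_dᴴΔ_d Ω⟩`.
* `ladderThesis_of_onePointSourcedOrder` — **composition to the crux by name** (the idea's
  `SourcedPenaltyCorner`): exposed filling + one-point sourced order `√a ≤ L⁻²Re⟨Ω, Δ_d Ω⟩` of the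
  ground vectors of the mesoscopically sourced (`h = h₀/L²`, `h₀ ≤ s·a/64`), penalised
  grand-canonical matrix, at all large even `L` ⇒ `LadderThesis` (via a uniform sector penalty gap
  `≥ (a/2)·s` and the landed normal form `ladderThesis_of_penaltyGap`). The two hypotheses are the
  typed stubs `ExposedFilling` / `OnePointSourcedOrder` of the idea, inlined (no new definition).

Kaplan–Horsch–von der Linden (1989) (order parameters at mesoscopic fields); Koma–Tasaki, J. Stat.
Phys. 76 (1994) 745, §1 (sourced Hamiltonians); Tasaki (2020) §2.1 (variational principle).
-/

noncomputable section

-- `dupNamespace`: the summit and the problem are both named `HubbardSuperconductivity` (layout D-0022)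
set_option linter.dupNamespace false

namespace Summit.HubbardSuperconductivity.HubbardSuperconductivity.Theorems.DeformationLadder

open Matrix Literature.MathematicalPhysics.QuantumLattice Literature.Probability.LatticeModels
open Summit.HubbardSuperconductivity.HubbardSuperconductivity.Theses.DeformationLadder
open scoped Matrix.Norms.L2Operator ComplexOrder

/-! ### Graded operators have zero expectation in a fixed sector -/

section Graded

variable {Λ : Type*} [LinearOrder Λ] [Fintype Λ]

/-- An operator `M` of `(N↑, N↓)`-grade `(a, b) ≠ (0, 0)` has zero expectation `⟨ψ, M ψ⟩ = 0` in
every vector `ψ` supported on one `(N↑, N↓) = (n, m)` sector: a nonzero term `ψ̄(s) M(s,t) ψ(t)`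
would need `s, t` in the sector and `M(s,t) ≠ 0`, i.e. `n = n + a`, `m = m + b`.
Tasaki (2020) §9.3. [folklore] -/
theorem star_dotProduct_mulVec_eq_zero_of_shifts {a b : ℤ} (hab : a ≠ 0 ∨ b ≠ 0)
    {M : Matrix (Finset (Orb Λ)) (Finset (Orb Λ)) ℂ} (hM : PairChirality.Shifts a b M)
    {n m : ℕ} {ψ : Fock (Orb Λ)} (hψ : IsInSector n m ψ) :
    star ψ ⬝ᵥ M *ᵥ ψ = 0 := by
  simp only [dotProduct, mulVec, Pi.star_apply]
  refine Finset.sum_eq_zero fun s _ => ?_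
  by_cases hs : (upPart s).card = n ∧ (downPart s).card = m
  · rw [Finset.mul_sum]
    refine Finset.sum_eq_zero fun t _ => ?_
    by_cases ht : (upPart t).card = n ∧ (downPart t).card = m
    · by_cases hMst : M s t = 0
      · rw [hMst, zero_mul, mul_zero]
      · exfalso
        obtain ⟨h1, h2⟩ := hM s t hMst
        rw [hs.1, ht.1] at h1
        rw [hs.2, ht.2] at h2
        rcases hab with h | h
        · exact h (by linarith)
        · exact h (by linarith)
    · rw [hψ t ht, mul_zero, mul_zero]
  · rw [hψ s hs, star_zero, zero_mul]

end Graded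

/-! ### The sourced, penalised torus -/

section Torus

variable (L : ℕ) [NeZero L]

/-- `Δ_d` has `(N↑, N↓)`-grade `(-1, -1)`. Tasaki (2020) §9.3. [folklore] -/
theorem shifts_pairField_dWave :
    PairChirality.Shifts (-1) (-1) (pairField dWaveFormFactor L) :=
  PairChirality.Shifts.sum fun x _ => PairChirality.shifts_localPair L dWaveFormFactor x

/-- **The pair source has zero expectation in a fixed-`N` sector**: for `ψ ∈ szSector (2n) 0`,
`⟨ψ, (Δ_d + Δ_dᴴ) ψ⟩ = 0` (`Δ_d` lowers, `Δ_dᴴ` raises the particle number by two).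
Koma–Tasaki (1994) §1. [folklore] -/
theorem star_dotProduct_dWavePairSource_mulVec_eq_zero {n : ℕ} {ψ : Fock (Orb (FermionTorus 2 L))}
    (hψ : ψ ∈ szSector (2 * n) 0) :
    star ψ ⬝ᵥ (pairField dWaveFormFactor L + (pairField dWaveFormFactor L)ᴴ) *ᵥ ψ = 0 := by
  have hsec : IsInSector n n ψ := (mem_szSector_two_mul_zero_iff n ψ).1 hψ
  have hP := shifts_pairField_dWave L
  have hPc : PairChirality.Shifts 1 1 (pairField dWaveFormFactor L)ᴴ := by
    simpa using hP.conjTranspose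
  rw [add_mulVec, dotProduct_add,
    star_dotProduct_mulVec_eq_zero_of_shifts (Or.inl (by norm_num)) hP hsec,
    star_dotProduct_mulVec_eq_zero_of_shifts (Or.inl (by norm_num)) hPc hsec, add_zero]

/-- The sourced, penalised torus Hamiltonian regrouped:
`H_L - μN - h(Δ_d + Δ_dᴴ) + sΔ_dᴴΔ_d = ((H_L + sΔ_dᴴΔ_d) - μN) - h(Δ_d + Δ_dᴴ)`. [folklore] -/
theorem dWaveSourceTorus_add_penalty_eq (U μ h s : ℝ) :
    dWaveSourceTorus L U μ h +
        ((s : ℝ) : ℂ) • ((pairField dWaveFormFactor L)ᴴ * pairField dWaveFormFactor L) =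
      (hubbardTorus 2 L 1 U +
            ((s : ℝ) : ℂ) • ((pairField dWaveFormFactor L)ᴴ * pairField dWaveFormFactor L) -
          (μ : ℂ) • totalNumber) -
        (h : ℂ) • (pairField dWaveFormFactor L + (pairField dWaveFormFactor L)ᴴ) := by
  simp only [dWaveSourceTorus, hubbardTorusWith_eq]
  abel

/-- The sourced, penalised torus Hamiltonian is Hermitian (real `h`, `s`). [folklore] -/
theorem isHermitian_dWaveSourceTorus_add_penalty (U μ h s : ℝ) :
    (dWaveSourceTorus L U μ h +
        ((s : ℝ) : ℂ) • ((pairField dWaveFormFactor L)ᴴ * pairField dWaveFormFactor L)).IsHermitian :=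
  (dWaveSourceTorus_isHermitian L (isHermitian_hubbardTorusWith L 1 U μ) h).add
    ((pairField_conjTranspose_mul_self_posSemidef dWaveFormFactor L).isHermitian.smul
      (by rw [isSelfAdjoint_iff, Complex.star_def, Complex.conj_ofReal]))

/-- **Variational upper bound for the sourced, penalised ground energy.** For `n ≤ L²` and real
`U, μ, h, s`:
`E₀(H_L - μN - h(Δ_d + Δ_dᴴ) + sΔ_dᴴΔ_d) ≤ minEnergyOn (H_L + sΔ_dᴴΔ_d) (szSector 2n 0) - 2nμ`.
Trial state: a unit sector ground state `φ` of `H_L + sΔ_dᴴΔ_d` (`penalisedGroundStateExists_proof`);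
on it `N = 2n` and the source has zero expectation. Tasaki (2020) §2.1, (2.1.6).
[cite: KaplanHorschVonDerLinden1989] -/
theorem groundEnergy_sourcedPenalised_le (U μ h s : ℝ) {n : ℕ} (hn : n ≤ L ^ 2) :
    (dWaveSourceTorus L U μ h +
          ((s : ℝ) : ℂ) • ((pairField dWaveFormFactor L)ᴴ * pairField dWaveFormFactor L)).groundEnergy ≤
      (hubbardTorus 2 L 1 U +
            ((s : ℝ) : ℂ) • ((pairField dWaveFormFactor L)ᴴ * pairField dWaveFormFactor L)).minEnergyOn
          (szSector (2 * n) 0) -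
        μ * (2 * n) := by
  obtain ⟨φ, hφ1, hφ⟩ := penalisedGroundStateExists_proof L U s n hn
  set Hs := hubbardTorus 2 L 1 U +
    ((s : ℝ) : ℂ) • ((pairField dWaveFormFactor L)ᴴ * pairField dWaveFormFactor L) with hHs
  have hray := groundEnergy_le_rayleigh_holds (isHermitian_dWaveSourceTorus_add_penalty L U μ h s) φ hφ1
  have h1 : (Hs - (μ : ℂ) • totalNumber) *ᵥ φ =
      ((Hs.minEnergyOn (szSector (2 * n) 0) - μ * ((2 * n : ℕ) : ℝ) : ℝ) : ℂ) • φ := by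
    have := sub_smul_totalNumber_mulVec_of_isGroundStateInSector hφ μ
    simpa using this
  have h2 : star φ ⬝ᵥ (pairField dWaveFormFactor L + (pairField dWaveFormFactor L)ᴴ) *ᵥ φ = 0 :=
    star_dotProduct_dWavePairSource_mulVec_eq_zero L hφ.1
  have hval : star φ ⬝ᵥ (dWaveSourceTorus L U μ h +
      ((s : ℝ) : ℂ) • ((pairField dWaveFormFactor L)ᴴ * pairField dWaveFormFactor L)) *ᵥ φ =
        ((Hs.minEnergyOn (szSector (2 * n) 0) - μ * ((2 * n : ℕ) : ℝ) : ℝ) : ℂ) := by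
    rw [dWaveSourceTorus_add_penalty_eq, ← hHs, sub_mulVec, smul_mulVec, h1, dotProduct_sub,
      dotProduct_smul, dotProduct_smul, hφ1, h2, smul_eq_mul, mul_one, smul_zero, sub_zero]
  rw [hval, Complex.ofReal_re] at hray
  push_cast at hray
  linarith

/-- **Source removal costs at most `8√2·|h|·L²`**:
`E₀(H_L - μN) - 8√2|h|L² ≤ E₀(H_L - μN - h(Δ_d + Δ_dᴴ))` (Hellmann–Feynman chord with the tracial
ground state of the sourced matrix, `|Re ω(Δ_d + Δ_dᴴ)| ≤ ‖Δ_d + Δ_dᴴ‖ ≤ 8√2 L²`).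
Koma–Tasaki (1994) §1. [cite: KomaTasaki1994, §1] -/
theorem groundEnergy_hubbardTorusWith_sub_le_groundEnergy_dWaveSourceTorus (U μ h : ℝ) :
    (hubbardTorusWith 2 L 1 U μ).groundEnergy - 8 * Real.sqrt 2 * |h| * (L : ℝ) ^ 2 ≤
      (dWaveSourceTorus L U μ h).groundEnergy := by
  have hK : (hubbardTorusWith 2 L 1 U μ).IsHermitian := isHermitian_hubbardTorusWith L 1 U μ
  have hO : (pairField dWaveFormFactor L + (pairField dWaveFormFactor L)ᴴ).IsHermitian :=
    isHermitian_pairField_add_conjTranspose L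
  have h1 := sub_mul_re_groundStateFunctional_le hK hO h 0
  rw [Complex.ofReal_zero, zero_smul, sub_zero] at h1
  have h2 : |h * ((hubbardTorusWith 2 L 1 U μ -
      (h : ℂ) • (pairField dWaveFormFactor L + (pairField dWaveFormFactor L)ᴴ)).groundStateFunctional
        (pairField dWaveFormFactor L + (pairField dWaveFormFactor L)ᴴ)).re| ≤
      |h| * (8 * Real.sqrt 2 * (L : ℝ) ^ 2) := by
    rw [abs_mul]
    refine mul_le_mul_of_nonneg_left ?_ (abs_nonneg h)
    exact (abs_re_groundStateFunctional_le_norm (isHermitian_sub_real_smul hK hO h) _).trans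
      (norm_dWavePairSource_le L)
  have h3 := le_abs_self (h * ((hubbardTorusWith 2 L 1 U μ -
      (h : ℂ) • (pairField dWaveFormFactor L + (pairField dWaveFormFactor L)ᴴ)).groundStateFunctional
        (pairField dWaveFormFactor L + (pairField dWaveFormFactor L)ᴴ)).re)
  change (hubbardTorusWith 2 L 1 U μ).groundEnergy - 8 * Real.sqrt 2 * |h| * (L : ℝ) ^ 2 ≤
    (hubbardTorusWith 2 L 1 U μ -
      (h : ℂ) • (pairField dWaveFormFactor L + (pairField dWaveFormFactor L)ᴴ)).groundEnergy
  nlinarith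

/-- **The source–penalty transfer** (first lemma `SourcePenaltyTransfer` of crux-idea
`mesoscopic-source-concavity` on `stmt-HubbardSuperconductivity-1890`, at a nonempty sector
`(2n, S^z=0)`, `n ≤ L²`). If the filling `2n` is EXPOSED at chemical potential `μ`, i.e. the
grand-canonical ground energy of `H_L - μN` is attained in the sector,
`E₀(H_L - μN) = minEnergyOn H_L (szSector 2n 0) - 2nμ`, then for all real `h, s`:
`E₀(H_L - μN - h(Δ_d+Δ_dᴴ) + sΔ_dᴴΔ_d) - E₀(H_L - μN - h(Δ_d+Δ_dᴴ)) - 8√2|h|L²`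
`  ≤ minEnergyOn (H_L + sΔ_dᴴΔ_d) (szSector 2n 0) - minEnergyOn H_L (szSector 2n 0)`:
the grand-canonical, explicitly `U(1)`-broken penalty shift at a (mesoscopic) source `h` bounds the
SECTOR penalty shift `Φ_L(s)` from below up to the source-removal cost `8√2|h|L²` — and uniform
positivity of `Φ_L(s)` is `LadderThesis` (`ladderThesis_iff_penaltyGap`). Variational upper bound
(`groundEnergy_sourcedPenalised_le`) minus source removal
(`groundEnergy_hubbardTorusWith_sub_le_groundEnergy_dWaveSourceTorus`) and the exposedness identity.
Kaplan–Horsch–von der Linden (1989); Koma–Tasaki (1994) §1. [cite: KaplanHorschVonDerLinden1989] -/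
theorem sourcePenaltyTransfer (U μ h s : ℝ) {n : ℕ} (hn : n ≤ L ^ 2)
    (hexp : (hubbardTorusWith 2 L 1 U μ).groundEnergy =
      (hubbardTorus 2 L 1 U).minEnergyOn (szSector (2 * n) 0) - μ * (2 * n)) :
    (dWaveSourceTorus L U μ h +
            ((s : ℝ) : ℂ) • ((pairField dWaveFormFactor L)ᴴ * pairField dWaveFormFactor L)).groundEnergy -
          (dWaveSourceTorus L U μ h).groundEnergy -
        8 * Real.sqrt 2 * |h| * (L : ℝ) ^ 2 ≤
      (hubbardTorus 2 L 1 U +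
            ((s : ℝ) : ℂ) • ((pairField dWaveFormFactor L)ᴴ * pairField dWaveFormFactor L)).minEnergyOn
          (szSector (2 * n) 0) -
        (hubbardTorus 2 L 1 U).minEnergyOn (szSector (2 * n) 0) := by
  have h1 := groundEnergy_sourcedPenalised_le L U μ h s hn
  have h2 := groundEnergy_hubbardTorusWith_sub_le_groundEnergy_dWaveSourceTorus L U μ h
  rw [hexp] at h2
  linarith

/-- **The penalty shift dominates the penalised expectation of the penalty**: if `Ω` is a unit
ground-state vector of the sourced, penalised matrix `K₁ = K₀ + s·Δ_dᴴΔ_d`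
(`K₀ = H_L - μN - h(Δ_d + Δ_dᴴ)`), then `s·Re⟨Ω, Δ_dᴴΔ_d Ω⟩ ≤ E₀(K₁) - E₀(K₀)` (`Ω` is a trial
state for `K₀`; Feynman–Hellmann / concavity in `s` at finite size). Tasaki (2020) §2.1, (2.1.6).
[cite: KaplanHorschVonDerLinden1989] -/
theorem smul_re_expect_pairPenalty_le_groundEnergy_sub (U μ h s : ℝ)
    {Ω : Fock (Orb (FermionTorus 2 L))} (hΩ1 : star Ω ⬝ᵥ Ω = 1)
    (hΩ : Matrix.IsGroundStateVector (dWaveSourceTorus L U μ h +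
      ((s : ℝ) : ℂ) • ((pairField dWaveFormFactor L)ᴴ * pairField dWaveFormFactor L)) Ω) :
    s * (expect ((pairField dWaveFormFactor L)ᴴ * pairField dWaveFormFactor L) Ω).re ≤
      (dWaveSourceTorus L U μ h +
            ((s : ℝ) : ℂ) • ((pairField dWaveFormFactor L)ᴴ * pairField dWaveFormFactor L)).groundEnergy -
        (dWaveSourceTorus L U μ h).groundEnergy := by
  set K₁ := dWaveSourceTorus L U μ h +
    ((s : ℝ) : ℂ) • ((pairField dWaveFormFactor L)ᴴ * pairField dWaveFormFactor L) with hK₁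
  have hK₀h : (dWaveSourceTorus L U μ h).IsHermitian :=
    dWaveSourceTorus_isHermitian L (isHermitian_hubbardTorusWith L 1 U μ) h
  have hray := groundEnergy_le_rayleigh_holds hK₀h Ω hΩ1
  have hdec : dWaveSourceTorus L U μ h =
      K₁ - ((s : ℝ) : ℂ) • ((pairField dWaveFormFactor L)ᴴ * pairField dWaveFormFactor L) := by
    rw [hK₁, add_sub_cancel_right]
  have hval : star Ω ⬝ᵥ (dWaveSourceTorus L U μ h) *ᵥ Ω =
      (K₁.groundEnergy : ℂ) -
        ((s : ℝ) : ℂ) * expect ((pairField dWaveFormFactor L)ᴴ * pairField dWaveFormFactor L) Ω := by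
    rw [hdec, sub_mulVec, smul_mulVec, hΩ.2, dotProduct_sub, dotProduct_smul, dotProduct_smul, hΩ1,
      smul_eq_mul, mul_one, smul_eq_mul, expect]
  rw [hval, Complex.sub_re, Complex.ofReal_re, Complex.re_ofReal_mul] at hray
  linarith

/-- **Cauchy–Schwarz for the pair field**: for a unit vector `Ω`,
`(Re⟨Ω, Δ_d Ω⟩)² ≤ Re⟨Ω, Δ_dᴴΔ_d Ω⟩ = ‖Δ_d Ω‖²`. [folklore] -/
theorem re_expect_pairField_sq_le {Ω : Fock (Orb (FermionTorus 2 L))} (hΩ1 : star Ω ⬝ᵥ Ω = 1) :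
    (expect (pairField dWaveFormFactor L) Ω).re ^ 2 ≤
      (expect ((pairField dWaveFormFactor L)ᴴ * pairField dWaveFormFactor L) Ω).re := by
  have h1 : |(expect (pairField dWaveFormFactor L) Ω).re| ≤ ‖expect (pairField dWaveFormFactor L) Ω‖ :=
    Complex.abs_re_le_norm _
  have h2 : ‖expect (pairField dWaveFormFactor L) Ω‖ ≤ eucNorm (pairField dWaveFormFactor L *ᵥ Ω) :=
    norm_star_dotProduct_le_eucNorm hΩ1 _
  have h3 : eucNorm (pairField dWaveFormFactor L *ᵥ Ω) ^ 2 =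
      (expect ((pairField dWaveFormFactor L)ᴴ * pairField dWaveFormFactor L) Ω).re := by
    rw [eucNorm_sq, expect, ← star_mulVec_dotProduct_mulVec]
  calc (expect (pairField dWaveFormFactor L) Ω).re ^ 2
      = |(expect (pairField dWaveFormFactor L) Ω).re| ^ 2 := (sq_abs _).symm
    _ ≤ eucNorm (pairField dWaveFormFactor L *ᵥ Ω) ^ 2 := pow_le_pow_left₀ (abs_nonneg _) (h1.trans h2) 2
    _ = _ := h3

end Torus

/-! ### Composition: the source door to `LadderThesis` -/

section Corner

/-- **`LadderThesis` through the source door** (composition target `SourcedPenaltyCorner` of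
crux-idea `mesoscopic-source-concavity`, hypotheses inlined). Suppose that for some `U > 0`,
`δ ∈ (0,1/2)`, `s > 0`, `a > 0`, a source amplitude `0 ≤ h₀ ≤ s·a/64`, chemical potentials `μ_L`
and all large even `L`: (i) the filling `N_L = 2⌊(1-δ)L²/2⌋` is EXPOSED at `μ_L`
(`E₀(H_L - μ_L N) = minEnergyOn H_L (szSector N_L 0) - N_L μ_L`), and (ii) ONE-POINT SOURCED ORDER:
every unit ground-state vector `Ω` of the mesoscopically sourced, penalised grand-canonical matrix
`H_L - μ_L N - (h₀/L²)(Δ_d + Δ_dᴴ) + (s/L⁴)Δ_dᴴΔ_d` has `√a ≤ L⁻² Re⟨Ω, Δ_d Ω⟩`. Then `LadderThesis`: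
by Cauchy–Schwarz `Re⟨Ω, Δ_dᴴΔ_d Ω⟩ ≥ a L⁴`, so the grand-canonical penalty shift is `≥ s·a`
(`smul_re_expect_pairPenalty_le_groundEnergy_sub`); the transfer (`sourcePenaltyTransfer`) loses
`8√2·h₀ ≤ s·a/4`, leaving a uniform SECTOR penalty gap `≥ (a/2)·s`, and `ladderThesis_of_penaltyGap`
(normal form II) concludes. Kaplan–Horsch–von der Linden (1989); Koma–Tasaki (1994) §1;
Kato (1966) II-§5.4. [cite: KaplanHorschVonDerLinden1989] -/
theorem ladderThesis_of_onePointSourcedOrder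
    (h : ∃ U : ℝ, 0 < U ∧ ∃ δ ∈ Set.Ioo (0:ℝ) (1 / 2), ∃ s : ℝ, 0 < s ∧ ∃ a : ℝ, 0 < a ∧
      ∃ h₀ : ℝ, 0 ≤ h₀ ∧ h₀ ≤ s * a / 64 ∧ ∃ μ : ℕ → ℝ, ∃ L₀ : ℕ, ∀ (L : ℕ) [NeZero L], L₀ ≤ L → Even L →
        (hubbardTorusWith 2 L 1 U (μ L)).groundEnergy =
            (hubbardTorus 2 L 1 U).minEnergyOn (szSector (2 * ⌊(1 - δ) * (L : ℝ) ^ 2 / 2⌋₊) 0) -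
              μ L * (2 * ⌊(1 - δ) * (L : ℝ) ^ 2 / 2⌋₊) ∧
        ∀ Ω : Fock (Orb (FermionTorus 2 L)), star Ω ⬝ᵥ Ω = 1 →
          Matrix.IsGroundStateVector (dWaveSourceTorus L U (μ L) (h₀ / (L : ℝ) ^ 2) +
              ((s / (L : ℝ) ^ 4 : ℝ) : ℂ) •
                ((pairField dWaveFormFactor L)ᴴ * pairField dWaveFormFactor L)) Ω →
            Real.sqrt a ≤ (expect (pairField dWaveFormFactor L) Ω).re / (L : ℝ) ^ 2) :
    LadderThesis := by
  obtain ⟨U, hU, δ, hδ, s, hs, a, ha, h₀, hh₀, hh₀', μ, L₀, hyp⟩ := h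
  apply ladderThesis_of_penaltyGap
  refine ⟨U, hU, δ, hδ, s, hs, a / 2, by positivity, L₀, fun L _ hL hE => ?_⟩
  obtain ⟨hexp, hord⟩ := hyp L hL hE
  set n : ℕ := ⌊(1 - δ) * (L : ℝ) ^ 2 / 2⌋₊ with hn
  have hnL : n ≤ L ^ 2 := by
    have h1 : ((1 - δ) * (L : ℝ) ^ 2 / 2) ≤ (L : ℝ) ^ 2 := by
      have : 0 ≤ (L : ℝ) ^ 2 := by positivity
      nlinarith [hδ.1, hδ.2]
    have h2 : (n : ℝ) ≤ (L : ℝ) ^ 2 :=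
      (Nat.floor_le (by nlinarith [hδ.1, hδ.2, sq_nonneg (L : ℝ)])).trans h1
    exact_mod_cast h2
  set K₁ := dWaveSourceTorus L U (μ L) (h₀ / (L : ℝ) ^ 2) +
    ((s / (L : ℝ) ^ 4 : ℝ) : ℂ) • ((pairField dWaveFormFactor L)ᴴ * pairField dWaveFormFactor L) with hK₁
  have hL0 : (0 : ℝ) < L := Nat.cast_pos.2 (Nat.pos_of_ne_zero (NeZero.ne L))
  have hL2 : (0 : ℝ) < (L : ℝ) ^ 2 := by positivity
  have hL4 : (0 : ℝ) < (L : ℝ) ^ 4 := by positivity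
  -- a unit ground-state vector of `K₁`
  have hK₁h : K₁.IsHermitian := isHermitian_dWaveSourceTorus_add_penalty L U (μ L) _ _
  obtain ⟨Ω, hΩ1, hΩ⟩ : ∃ Ω, star Ω ⬝ᵥ Ω = 1 ∧ Matrix.IsGroundStateVector K₁ Ω := by
    have hne := groundSpace_ne_bot_holds hK₁h
    obtain ⟨ψ, hψmem, hψ0⟩ := Submodule.exists_mem_ne_zero_of_ne_bot hne
    obtain ⟨c, hc, hc1⟩ := exists_smul_unit hψ0
    refine ⟨c • ψ, hc1, smul_ne_zero hc hψ0, ?_⟩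
    rw [mulVec_smul, (mem_groundSpace_iff K₁ ψ).1 hψmem, smul_comm]
  -- one-point order and Cauchy–Schwarz: `Re⟨Ω, Δ_dᴴΔ_d Ω⟩ ≥ a L⁴`
  have hM : Real.sqrt a * (L : ℝ) ^ 2 ≤ (expect (pairField dWaveFormFactor L) Ω).re := by
    have := hord Ω hΩ1 hΩ
    rwa [le_div_iff₀ hL2] at this
  have hPge : a * (L : ℝ) ^ 4 ≤
      (expect ((pairField dWaveFormFactor L)ᴴ * pairField dWaveFormFactor L) Ω).re := by
    have h0 : 0 ≤ Real.sqrt a * (L : ℝ) ^ 2 := by positivity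
    have h1 := pow_le_pow_left₀ h0 hM 2
    rw [mul_pow, Real.sq_sqrt ha.le] at h1
    calc a * (L : ℝ) ^ 4 = a * ((L : ℝ) ^ 2) ^ 2 := by ring
      _ ≤ (expect (pairField dWaveFormFactor L) Ω).re ^ 2 := h1
      _ ≤ _ := re_expect_pairField_sq_le L hΩ1
  -- the grand-canonical penalty shift is `≥ s a`
  have hshift := smul_re_expect_pairPenalty_le_groundEnergy_sub L U (μ L) (h₀ / (L : ℝ) ^ 2)
    (s / (L : ℝ) ^ 4) hΩ1 hΩ
  have hsa : s * a ≤ K₁.groundEnergy - (dWaveSourceTorus L U (μ L) (h₀ / (L : ℝ) ^ 2)).groundEnergy :=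
    calc s * a = (s / (L : ℝ) ^ 4) * (a * (L : ℝ) ^ 4) := by field_simp
      _ ≤ (s / (L : ℝ) ^ 4) *
            (expect ((pairField dWaveFormFactor L)ᴴ * pairField dWaveFormFactor L) Ω).re :=
          mul_le_mul_of_nonneg_left hPge (by positivity)
      _ ≤ _ := hshift
  -- the transfer to the sector, losing `8√2 h₀ ≤ s a / 4`
  have htr := sourcePenaltyTransfer L U (μ L) (h₀ / (L : ℝ) ^ 2) (s / (L : ℝ) ^ 4) hnL hexp
  have habs : 8 * Real.sqrt 2 * |h₀ / (L : ℝ) ^ 2| * (L : ℝ) ^ 2 = 8 * Real.sqrt 2 * h₀ := by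
    rw [abs_of_nonneg (by positivity)]
    field_simp
  rw [habs] at htr
  have hsqrt2 : Real.sqrt 2 ≤ 2 := by
    rw [Real.sqrt_le_left (by norm_num)]
    norm_num
  have hloss : 8 * Real.sqrt 2 * h₀ ≤ s * a / 4 := by
    have h1 : 8 * Real.sqrt 2 * h₀ ≤ 8 * 2 * h₀ := by
      have := mul_le_mul_of_nonneg_right hsqrt2 hh₀
      nlinarith
    nlinarith
  linarith

end Corner

end Summit.HubbardSuperconductivity.HubbardSuperconductivity.Theorems.DeformationLadder

end
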